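import Mathlib.LinearAlgebra.Matrix.Kronecker
import Mathlib.Data.Fintype.Powerset
import Literature.Computability.AlgebraicComplexity.LRPencilOfMatrix
import Literature.Computability.AlgebraicComplexity.EquivariantDC
import HarnessLib

/-!
# Landsberg–Ressayre's equivariant determinantal representation of the permanent, III:
# vertex relabellings — the permutation symmetries and the transposition (LR 2017, Prop. 2.10)

Topic `Literature/Computability/AlgebraicComplexity`; companion of `LandsbergRessayrePairsProgram.lean` /
`…PairsMinor.lean` (independent of them: only the adjacency hypothesis `hA` is used).
A substitution of the variables that RELABELS the vertices of the pairs program by a permutation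
`ρ` fixing source and sink (`(1 - A)(γ · x) = (1 - A).submatrix ρ ρ`) acts on the signed minor `M₀`
by constant permutation matrices (`exists_perm_succAbove`, `exists_lift_of_relabel`; the pattern of
`Summits/…/ProjectionStabilityOptStepStubGrenetLeftEquivariant.lean` for Grenet's matrix, made
index-generic). The three relabellings of LR's construction:
* left `P_π ⊗ 1` (`X (p, q) ↦ X (π⁻¹ p, q)`): `(I, J) ↦ (π⁻¹ I, J)` — `linSubst_leftPerm_apply`,
  `exists_lift_leftPerm`;
* right `1 ⊗ P_π` (`X (p, q) ↦ X (p, π⁻¹ q)`): `(I, J) ↦ (I, π⁻¹ J)` — `linSubst_rightPerm_apply`,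
  `exists_lift_rightPerm`;
* transposition `x ↦ xᵀ` (`X (p, q) ↦ X (q, p)`): `(I, J) ↦ (J, I)` — `linSubst_transpose_apply`,
  `exists_lift_transpose` (so the `ℤ₂` of `𝔾_{perm_m}` lifts WITHOUT transposing the big matrix:
  conjugation by the vertex swap suffices: the tree's transpose-free `IsEquivariantDetRepr` is met).
No definitions. Honest framing: known construction.
## References

* J. M. Landsberg, N. Ressayre, *Permanent v. determinant: an exponential lower bound assuming
  symmetry and a potential path towards Valiant's conjecture*, Differential Geom. Appl. 55 (2017)
  146–166, arXiv:1508.05788: §2.3, Prop. 2.10 (held text `paper:arxiv-1508.05788` p0006);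
  Thm. 2.1 (`edc(perm_m) = C(2m,m) - 1`, `m ≥ 3`). [LandsbergRessayre2017]
* B. Grenet, *An upper bound for the permanent versus determinant problem* (2011), Thm. 1 — the
  one-sided model of the construction (tree: `PermanentVsDeterminantProofs.lean`,
  `GrenetEquivariant.lean`). [Grenet2011]
-/

noncomputable section

open MvPolynomial Matrix Finset
open scoped Kronecker

namespace Literature.Computability.AlgebraicComplexity

namespace LRPairs

/-! ### Vertex relabellings fixing source and sink act on the minor by permutation matrices -/

section Relabel

/-- A permutation `ρ` of the vertex set fixing a "hole" `h` permutes the indices of the minor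
deleting `h`: there is `α ∈ 𝔖_N` with `e⁻¹((e h).succAbove (α i)) = ρ (e⁻¹ ((e h).succAbove i))`
(generic form of the lemma of the same name for Grenet's program). [folklore] -/
private theorem exists_perm_succAbove {ι : Type*} {N : ℕ} (e : ι ≃ Fin (N + 1)) (ρ : Equiv.Perm ι) (h : ι)
    (hh : ρ h = h) :
    ∃ α : Equiv.Perm (Fin N), ∀ i, e.symm ((e h).succAbove (α i)) = ρ (e.symm ((e h).succAbove i)) := by
  have key : ∀ i, ∃ i', e.symm ((e h).succAbove i') = ρ (e.symm ((e h).succAbove i)) := by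
    intro i
    have hne : ρ (e.symm ((e h).succAbove i)) ≠ h := by
      intro H
      have H' : e.symm ((e h).succAbove i) = h := by
        apply ρ.injective
        rw [H, hh]
      exact Fin.succAbove_ne (e h) i (e.symm_apply_eq.mp H')
    obtain ⟨z, hz⟩ := Fin.exists_succAbove_eq (e.injective.ne hne)
    exact ⟨z, by rw [hz, e.symm_apply_apply]⟩
  choose a ha using key
  have hinj : Function.Injective a := by
    intro i j hij
    have H : ρ (e.symm ((e h).succAbove i)) = ρ (e.symm ((e h).succAbove j)) := by
      rw [← ha i, ← ha j, hij]
    exact Fin.succAbove_right_injective (e.symm.injective (ρ.injective H))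
  exact ⟨Equiv.ofBijective a (Finite.injective_iff_bijective.mp hinj), ha⟩

/-- A row/column permutation of a square matrix is the two-sided product with permutation
matrices: `M.submatrix α β = P_α · M · P_{β⁻¹}`. [folklore] -/
private theorem submatrix_eq_permMatrix_mul_mul {R : Type*} [Semiring R] {N : ℕ}
    (M : Matrix (Fin N) (Fin N) R) (α β : Equiv.Perm (Fin N)) :
    M.submatrix α β = α.permMatrix R * M * β⁻¹.permMatrix R := by
  rw [PEquiv.toMatrix_toPEquiv_mul, PEquiv.mul_toMatrix_toPEquiv, Matrix.submatrix_submatrix,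
    Function.comp_id, Function.id_comp, Equiv.Perm.inv_def, Equiv.symm_symm]

/-- Permutation matrices are constant: `(P_σ).map C = P_σ`. [folklore] -/
private theorem permMatrix_map_C {k : Type*} [CommRing k] {σ ι : Type*} [DecidableEq ι] (τ : Equiv.Perm ι) :
    (τ.permMatrix k).map (C : k →+* MvPolynomial σ k) = τ.permMatrix (MvPolynomial σ k) := by
  refine Matrix.ext fun i j => ?_
  simp only [Matrix.map_apply, PEquiv.toMatrix_apply]
  split_ifs
  · exact map_one _
  · exact map_zero _

/-- **A substitution that relabels the vertices, fixing source `s` and sink `t`, acts on the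
signed `(t, s)`-minor of `B` by constant permutation matrices**: if `B(γ · x) = B.submatrix ρ ρ`
with `ρ s = s`, `ρ t = t`, then `M₀(γ · x) = P_α · M₀ · P_β⁻¹`. [folklore] -/
private theorem exists_lift_of_relabel {k : Type*} [Field k] {σ ι : Type*} [Fintype σ] [DecidableEq σ]
    {N : ℕ} (e : ι ≃ Fin (N + 1)) (B : Matrix ι ι (MvPolynomial σ k))
    (γ : GL σ k) (ρ : Equiv.Perm ι) (s t : ι) (hs : ρ s = s) (ht : ρ t = t)
    (hB : B.map (linSubst σ k (γ : Matrix σ σ k)) = B.submatrix ρ ρ) :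
    ∃ P Q : GL (Fin N) k,
      Matrix.linSubstEntries γ
        ((-1 : MvPolynomial σ k) ^ ((e t : ℕ) + (e s : ℕ)) •
          (B.submatrix e.symm e.symm).submatrix (e t).succAbove (e s).succAbove) =
      (P : Matrix (Fin N) (Fin N) k).map C *
        ((-1 : MvPolynomial σ k) ^ ((e t : ℕ) + (e s : ℕ)) •
          (B.submatrix e.symm e.symm).submatrix (e t).succAbove (e s).succAbove) *
        (Q : Matrix (Fin N) (Fin N) k).map C := by
  obtain ⟨α, hα⟩ := exists_perm_succAbove e ρ t ht
  obtain ⟨β, hβ⟩ := exists_perm_succAbove e ρ s hs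
  refine ⟨LRPencil.permUnit k α, LRPencil.permUnit k β⁻¹, ?_⟩
  rw [LRPencil.coe_permUnit, LRPencil.coe_permUnit, permMatrix_map_C, permMatrix_map_C,
    ← submatrix_eq_permMatrix_mul_mul]
  unfold Matrix.linSubstEntries
  set F := linSubst σ k (γ : Matrix σ σ k) with hF
  have hsign : F ((-1 : MvPolynomial σ k) ^ ((e t : ℕ) + (e s : ℕ))) =
      (-1 : MvPolynomial σ k) ^ ((e t : ℕ) + (e s : ℕ)) := by
    rw [map_pow, map_neg, map_one]
  rw [Matrix.map_smul' _ _ _ (map_mul F), hsign, ← Matrix.submatrix_map, ← Matrix.submatrix_map, hF,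
    hB]
  refine Matrix.ext fun i j => ?_
  simp only [Matrix.smul_apply, Matrix.submatrix_apply]
  rw [hα i, hβ j]

variable {k : Type*} [Field k] {m : ℕ}

/-- `P_π ⊗ 1` is the permutation matrix of `π × 1` on index pairs. [folklore] -/
private theorem permMatrix_kronecker_one (π : Equiv.Perm (Fin m)) :
    π.permMatrix k ⊗ₖ (1 : Matrix (Fin m) (Fin m) k) =
      Equiv.Perm.permMatrix k (Equiv.prodCongr π (Equiv.refl (Fin m))) := by
  refine Matrix.ext fun p q => ?_
  obtain ⟨a, b⟩ := p
  obtain ⟨c, d⟩ := q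
  simp only [Matrix.kronecker_apply, PEquiv.toMatrix_apply, Equiv.toPEquiv_apply, Option.mem_def,
    Option.some.injEq, Matrix.one_apply, Equiv.prodCongr_apply, Prod.map_apply, Equiv.coe_refl,
    id_eq, Prod.mk.injEq]
  by_cases h1 : π a = c <;> by_cases h2 : b = d <;> simp [h1, h2]

/-- `1 ⊗ P_π` is the permutation matrix of `1 × π` on index pairs. [folklore] -/
private theorem one_kronecker_permMatrix (π : Equiv.Perm (Fin m)) :
    (1 : Matrix (Fin m) (Fin m) k) ⊗ₖ π.permMatrix k =
      Equiv.Perm.permMatrix k (Equiv.prodCongr (Equiv.refl (Fin m)) π) := by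
  refine Matrix.ext fun p q => ?_
  obtain ⟨a, b⟩ := p
  obtain ⟨c, d⟩ := q
  simp only [Matrix.kronecker_apply, PEquiv.toMatrix_apply, Equiv.toPEquiv_apply, Option.mem_def,
    Option.some.injEq, Matrix.one_apply, Equiv.prodCongr_apply, Prod.map_apply, Equiv.coe_refl,
    id_eq, Prod.mk.injEq]
  by_cases h1 : a = c <;> by_cases h2 : π b = d <;> simp [h1, h2]

/-- With the tree's convention `linSubst A (X i) = ∑ j, A j i • X j`, the left substitution
`P_π ⊗ 1` renames the FIRST index: `X (p, q) ↦ X (π⁻¹ p, q)`. [folklore] -/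
private theorem linSubst_permKron_X (π : Equiv.Perm (Fin m)) (p : Fin m × Fin m) :
    linSubst (Fin m × Fin m) k (π.permMatrix k ⊗ₖ (1 : Matrix (Fin m) (Fin m) k)) (X p) =
      X (π.symm p.1, p.2) := by
  rw [permMatrix_kronecker_one, linSubst_permMatrix, rename_X]
  rfl

/-- The right substitution `1 ⊗ P_π` renames the SECOND index: `X (p, q) ↦ X (p, π⁻¹ q)`.
[folklore] -/
private theorem linSubst_kronPerm_X (π : Equiv.Perm (Fin m)) (p : Fin m × Fin m) :
    linSubst (Fin m × Fin m) k ((1 : Matrix (Fin m) (Fin m) k) ⊗ₖ π.permMatrix k) (X p) =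
      X (p.1, π.symm p.2) := by
  rw [one_kronecker_permMatrix, linSubst_permMatrix, rename_X]
  rfl

/-- The transposition substitution swaps the indices: `X (p, q) ↦ X (q, p)`. [folklore] -/
private theorem linSubst_transpose_X (p : Fin m × Fin m) :
    linSubst (Fin m × Fin m) k (Equiv.Perm.permMatrix k (Equiv.prodComm (Fin m) (Fin m))) (X p) =
      X (p.2, p.1) := by
  rw [linSubst_permMatrix, rename_X]
  rfl

end Relabel


/-! ### The three relabellings: `(I, J) ↦ (π⁻¹ I, J)`, `(I, J) ↦ (I, π⁻¹ J)`, `(I, J) ↦ (J, I)` -/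

section RelabelAdj

variable {k : Type*} [Field k] {m : ℕ}

/-- **`P_π ⊗ 1` relabels the vertices by `(I, J) ↦ (π⁻¹ I, J)`**: `A(γ · x) P Q = A P' Q'` whenever
`P' = (π⁻¹ P.1, P.2)`, `Q' = (π⁻¹ Q.1, Q.2)`. [cite: LandsbergRessayre2017, Prop. 2.10] -/
theorem linSubst_leftPerm_apply (π : Equiv.Perm (Fin m))
    {A : Matrix {P : Finset (Fin m) × Finset (Fin m) // P.1.card = P.2.card}
      {P : Finset (Fin m) × Finset (Fin m) // P.1.card = P.2.card} (MvPolynomial (Fin m × Fin m) k)}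
    (hA : ∀ P Q, A P Q = ∑ i, ∑ j,
      if i ∉ P.1.1 ∧ j ∉ P.1.2 ∧ Q.1 = (insert i P.1.1, insert j P.1.2) then X (i, j) else 0)
    (P Q P' Q' : {P : Finset (Fin m) × Finset (Fin m) // P.1.card = P.2.card})
    (hP' : P'.1 = (P.1.1.map π.symm.toEmbedding, P.1.2))
    (hQ' : Q'.1 = (Q.1.1.map π.symm.toEmbedding, Q.1.2)) :
    linSubst (Fin m × Fin m) k (π.permMatrix k ⊗ₖ (1 : Matrix (Fin m) (Fin m) k)) (A P Q) = A P' Q' := by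
  rw [hA, hA, map_sum]
  have hP'1 : P'.1.1 = P.1.1.map π.symm.toEmbedding := by rw [hP']
  have hP'2 : P'.1.2 = P.1.2 := by rw [hP']
  rw [hP'1, hP'2, hQ']
  refine Fintype.sum_equiv π.symm _ _ fun i => ?_
  rw [map_sum]
  refine sum_congr rfl fun j _ => ?_
  have hmem : π.symm i ∈ P.1.1.map π.symm.toEmbedding ↔ i ∈ P.1.1 := Finset.mem_map' _
  have hins : (insert i P.1.1).map π.symm.toEmbedding = insert (π.symm i) (P.1.1.map π.symm.toEmbedding) :=
    Finset.map_insert _ _ _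
  have hiff : (π.symm i ∉ P.1.1.map π.symm.toEmbedding ∧ j ∉ P.1.2 ∧
      (Q.1.1.map π.symm.toEmbedding, Q.1.2) = (insert (π.symm i) (P.1.1.map π.symm.toEmbedding),
        insert j P.1.2)) ↔
      (i ∉ P.1.1 ∧ j ∉ P.1.2 ∧ Q.1 = (insert i P.1.1, insert j P.1.2)) := by
    rw [hmem, ← hins, Prod.mk.injEq, Finset.map_inj, Prod.ext_iff]
  by_cases h : i ∉ P.1.1 ∧ j ∉ P.1.2 ∧ Q.1 = (insert i P.1.1, insert j P.1.2)
  · rw [if_pos h, if_pos (hiff.mpr h), linSubst_permKron_X]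
  · rw [if_neg h, if_neg (mt hiff.mp h), map_zero]

/-- **`1 ⊗ P_π` relabels the vertices by `(I, J) ↦ (I, π⁻¹ J)`.** [cite: LandsbergRessayre2017, Prop. 2.10] -/
theorem linSubst_rightPerm_apply (π : Equiv.Perm (Fin m))
    {A : Matrix {P : Finset (Fin m) × Finset (Fin m) // P.1.card = P.2.card}
      {P : Finset (Fin m) × Finset (Fin m) // P.1.card = P.2.card} (MvPolynomial (Fin m × Fin m) k)}
    (hA : ∀ P Q, A P Q = ∑ i, ∑ j,
      if i ∉ P.1.1 ∧ j ∉ P.1.2 ∧ Q.1 = (insert i P.1.1, insert j P.1.2) then X (i, j) else 0)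
    (P Q P' Q' : {P : Finset (Fin m) × Finset (Fin m) // P.1.card = P.2.card})
    (hP' : P'.1 = (P.1.1, P.1.2.map π.symm.toEmbedding))
    (hQ' : Q'.1 = (Q.1.1, Q.1.2.map π.symm.toEmbedding)) :
    linSubst (Fin m × Fin m) k ((1 : Matrix (Fin m) (Fin m) k) ⊗ₖ π.permMatrix k) (A P Q) = A P' Q' := by
  rw [hA, hA, map_sum]
  have hP'1 : P'.1.1 = P.1.1 := by rw [hP']
  have hP'2 : P'.1.2 = P.1.2.map π.symm.toEmbedding := by rw [hP']
  rw [hP'1, hP'2, hQ']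
  refine sum_congr rfl fun i _ => ?_
  rw [map_sum]
  refine Fintype.sum_equiv π.symm _ _ fun j => ?_
  have hmem : π.symm j ∈ P.1.2.map π.symm.toEmbedding ↔ j ∈ P.1.2 := Finset.mem_map' _
  have hins : (insert j P.1.2).map π.symm.toEmbedding = insert (π.symm j) (P.1.2.map π.symm.toEmbedding) :=
    Finset.map_insert _ _ _
  have hiff : (i ∉ P.1.1 ∧ π.symm j ∉ P.1.2.map π.symm.toEmbedding ∧
      (Q.1.1, Q.1.2.map π.symm.toEmbedding) = (insert i P.1.1,
        insert (π.symm j) (P.1.2.map π.symm.toEmbedding))) ↔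
      (i ∉ P.1.1 ∧ j ∉ P.1.2 ∧ Q.1 = (insert i P.1.1, insert j P.1.2)) := by
    rw [hmem, ← hins, Prod.mk.injEq, Finset.map_inj, Prod.ext_iff]
  by_cases h : i ∉ P.1.1 ∧ j ∉ P.1.2 ∧ Q.1 = (insert i P.1.1, insert j P.1.2)
  · rw [if_pos h, if_pos (hiff.mpr h), linSubst_kronPerm_X]
  · rw [if_neg h, if_neg (mt hiff.mp h), map_zero]

/-- **The transposition `x ↦ xᵀ` relabels the vertices by `(I, J) ↦ (J, I)`.**
[cite: LandsbergRessayre2017, Prop. 2.10] -/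
theorem linSubst_transpose_apply
    {A : Matrix {P : Finset (Fin m) × Finset (Fin m) // P.1.card = P.2.card}
      {P : Finset (Fin m) × Finset (Fin m) // P.1.card = P.2.card} (MvPolynomial (Fin m × Fin m) k)}
    (hA : ∀ P Q, A P Q = ∑ i, ∑ j,
      if i ∉ P.1.1 ∧ j ∉ P.1.2 ∧ Q.1 = (insert i P.1.1, insert j P.1.2) then X (i, j) else 0)
    (P Q P' Q' : {P : Finset (Fin m) × Finset (Fin m) // P.1.card = P.2.card})
    (hP' : P'.1 = (P.1.2, P.1.1)) (hQ' : Q'.1 = (Q.1.2, Q.1.1)) :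
    linSubst (Fin m × Fin m) k (Equiv.Perm.permMatrix k (Equiv.prodComm (Fin m) (Fin m))) (A P Q) =
      A P' Q' := by
  rw [hA, hA, map_sum]
  have hP'1 : P'.1.1 = P.1.2 := by rw [hP']
  have hP'2 : P'.1.2 = P.1.1 := by rw [hP']
  rw [hP'1, hP'2, hQ']
  conv_rhs => rw [sum_comm]
  refine sum_congr rfl fun j _ => ?_
  rw [map_sum]
  refine sum_congr rfl fun i _ => ?_
  have hiff : (i ∉ P.1.2 ∧ j ∉ P.1.1 ∧ (Q.1.2, Q.1.1) = (insert i P.1.2, insert j P.1.1)) ↔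
      (j ∉ P.1.1 ∧ i ∉ P.1.2 ∧ Q.1 = (insert j P.1.1, insert i P.1.2)) := by
    rw [Prod.mk.injEq, Prod.ext_iff]
    tauto
  by_cases h : j ∉ P.1.1 ∧ i ∉ P.1.2 ∧ Q.1 = (insert j P.1.1, insert i P.1.2)
  · rw [if_pos h, if_pos (hiff.mpr h), linSubst_transpose_X]
  · rw [if_neg h, if_neg (mt hiff.mp h), map_zero]

/-- Matrix form of a relabelling: if `A(γ · x) P Q = A (ρ P) (ρ Q)` for a permutation `ρ` of the
vertices then `(1 - A)(γ · x) = (1 - A).submatrix ρ ρ`. [folklore] -/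
private theorem map_one_sub_eq_submatrix {ι σ R : Type*} [CommRing R] [DecidableEq ι] [Fintype σ]
    [DecidableEq σ] {A : Matrix ι ι (MvPolynomial σ R)} (F : MvPolynomial σ R →ₐ[R] MvPolynomial σ R)
    (ρ : Equiv.Perm ι) (h : ∀ P Q, F (A P Q) = A (ρ P) (ρ Q)) :
    (1 - A).map F = (1 - A).submatrix ρ ρ := by
  refine Matrix.ext fun P Q => ?_
  rw [Matrix.map_apply, Matrix.submatrix_apply, Matrix.sub_apply, Matrix.sub_apply, map_sub, h,
    Matrix.one_apply, Matrix.one_apply]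
  by_cases hPQ : P = Q
  · rw [if_pos hPQ, if_pos (by rw [hPQ]), map_one]
  · rw [if_neg hPQ, if_neg (fun H => hPQ (ρ.injective H)), map_zero]

end RelabelAdj


/-! ### Exact lifts of the generators on the signed minor -/

section Lifts

variable {k : Type*} [Field k] {m : ℕ}

/-- The left permutation substitution `P_π ⊗ 1` lifts exactly on the signed minor (via the vertex
relabelling `(I, J) ↦ (π⁻¹ I, J)`, which fixes source and sink). [cite: LandsbergRessayre2017, Prop. 2.10] -/
theorem exists_lift_leftPerm (π : Equiv.Perm (Fin m))
    {A : Matrix {P : Finset (Fin m) × Finset (Fin m) // P.1.card = P.2.card}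
      {P : Finset (Fin m) × Finset (Fin m) // P.1.card = P.2.card} (MvPolynomial (Fin m × Fin m) k)}
    (hA : ∀ P Q, A P Q = ∑ i, ∑ j,
      if i ∉ P.1.1 ∧ j ∉ P.1.2 ∧ Q.1 = (insert i P.1.1, insert j P.1.2) then X (i, j) else 0)
    {N : ℕ} (eqv : {P : Finset (Fin m) × Finset (Fin m) // P.1.card = P.2.card} ≃ Fin (N + 1))
    (γ : GL (Fin m × Fin m) k)
    (hγ : (γ : Matrix (Fin m × Fin m) (Fin m × Fin m) k) = π.permMatrix k ⊗ₖ 1) :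
    ∃ P Q : GL (Fin N) k,
      Matrix.linSubstEntries γ
        ((-1 : MvPolynomial (Fin m × Fin m) k) ^
            ((eqv ⟨(univ, univ), rfl⟩ : ℕ) + (eqv ⟨(∅, ∅), rfl⟩ : ℕ)) •
          ((1 - A).submatrix eqv.symm eqv.symm).submatrix (eqv ⟨(univ, univ), rfl⟩).succAbove
            (eqv ⟨(∅, ∅), rfl⟩).succAbove) =
      (P : Matrix (Fin N) (Fin N) k).map C *
        ((-1 : MvPolynomial (Fin m × Fin m) k) ^
            ((eqv ⟨(univ, univ), rfl⟩ : ℕ) + (eqv ⟨(∅, ∅), rfl⟩ : ℕ)) •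
          ((1 - A).submatrix eqv.symm eqv.symm).submatrix (eqv ⟨(univ, univ), rfl⟩).succAbove
            (eqv ⟨(∅, ∅), rfl⟩).succAbove) *
        (Q : Matrix (Fin N) (Fin N) k).map C := by
  let ρ : Equiv.Perm {P : Finset (Fin m) × Finset (Fin m) // P.1.card = P.2.card} :=
    (Equiv.prodCongr π.symm.finsetCongr (Equiv.refl (Finset (Fin m)))).subtypeEquiv fun P => by
      simp [Equiv.finsetCongr_apply, Finset.card_map]
  have hρ : ∀ P : {P : Finset (Fin m) × Finset (Fin m) // P.1.card = P.2.card},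
      (ρ P).1 = (P.1.1.map π.symm.toEmbedding, P.1.2) := fun P => rfl
  refine exists_lift_of_relabel eqv (1 - A) γ ρ ⟨(∅, ∅), rfl⟩ ⟨(univ, univ), rfl⟩
    (Subtype.ext (by rw [hρ]; simp)) (Subtype.ext (by rw [hρ]; simp)) ?_
  rw [hγ]
  exact map_one_sub_eq_submatrix _ ρ fun P Q => linSubst_leftPerm_apply π hA P Q (ρ P) (ρ Q) (hρ P) (hρ Q)

/-- The right permutation substitution `1 ⊗ P_π` lifts exactly on the signed minor (vertex
relabelling `(I, J) ↦ (I, π⁻¹ J)`). [cite: LandsbergRessayre2017, Prop. 2.10] -/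
theorem exists_lift_rightPerm (π : Equiv.Perm (Fin m))
    {A : Matrix {P : Finset (Fin m) × Finset (Fin m) // P.1.card = P.2.card}
      {P : Finset (Fin m) × Finset (Fin m) // P.1.card = P.2.card} (MvPolynomial (Fin m × Fin m) k)}
    (hA : ∀ P Q, A P Q = ∑ i, ∑ j,
      if i ∉ P.1.1 ∧ j ∉ P.1.2 ∧ Q.1 = (insert i P.1.1, insert j P.1.2) then X (i, j) else 0)
    {N : ℕ} (eqv : {P : Finset (Fin m) × Finset (Fin m) // P.1.card = P.2.card} ≃ Fin (N + 1))
    (γ : GL (Fin m × Fin m) k)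
    (hγ : (γ : Matrix (Fin m × Fin m) (Fin m × Fin m) k) = 1 ⊗ₖ π.permMatrix k) :
    ∃ P Q : GL (Fin N) k,
      Matrix.linSubstEntries γ
        ((-1 : MvPolynomial (Fin m × Fin m) k) ^
            ((eqv ⟨(univ, univ), rfl⟩ : ℕ) + (eqv ⟨(∅, ∅), rfl⟩ : ℕ)) •
          ((1 - A).submatrix eqv.symm eqv.symm).submatrix (eqv ⟨(univ, univ), rfl⟩).succAbove
            (eqv ⟨(∅, ∅), rfl⟩).succAbove) =
      (P : Matrix (Fin N) (Fin N) k).map C *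
        ((-1 : MvPolynomial (Fin m × Fin m) k) ^
            ((eqv ⟨(univ, univ), rfl⟩ : ℕ) + (eqv ⟨(∅, ∅), rfl⟩ : ℕ)) •
          ((1 - A).submatrix eqv.symm eqv.symm).submatrix (eqv ⟨(univ, univ), rfl⟩).succAbove
            (eqv ⟨(∅, ∅), rfl⟩).succAbove) *
        (Q : Matrix (Fin N) (Fin N) k).map C := by
  let ρ : Equiv.Perm {P : Finset (Fin m) × Finset (Fin m) // P.1.card = P.2.card} :=
    (Equiv.prodCongr (Equiv.refl (Finset (Fin m))) π.symm.finsetCongr).subtypeEquiv fun P => by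
      simp [Equiv.finsetCongr_apply, Finset.card_map]
  have hρ : ∀ P : {P : Finset (Fin m) × Finset (Fin m) // P.1.card = P.2.card},
      (ρ P).1 = (P.1.1, P.1.2.map π.symm.toEmbedding) := fun P => rfl
  refine exists_lift_of_relabel eqv (1 - A) γ ρ ⟨(∅, ∅), rfl⟩ ⟨(univ, univ), rfl⟩
    (Subtype.ext (by rw [hρ]; simp)) (Subtype.ext (by rw [hρ]; simp)) ?_
  rw [hγ]
  exact map_one_sub_eq_submatrix _ ρ fun P Q => linSubst_rightPerm_apply π hA P Q (ρ P) (ρ Q) (hρ P) (hρ Q)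

/-- The transposition substitution lifts exactly on the signed minor (vertex relabelling
`(I, J) ↦ (J, I)`). [cite: LandsbergRessayre2017, Prop. 2.10] -/
theorem exists_lift_transpose
    {A : Matrix {P : Finset (Fin m) × Finset (Fin m) // P.1.card = P.2.card}
      {P : Finset (Fin m) × Finset (Fin m) // P.1.card = P.2.card} (MvPolynomial (Fin m × Fin m) k)}
    (hA : ∀ P Q, A P Q = ∑ i, ∑ j,
      if i ∉ P.1.1 ∧ j ∉ P.1.2 ∧ Q.1 = (insert i P.1.1, insert j P.1.2) then X (i, j) else 0)
    {N : ℕ} (eqv : {P : Finset (Fin m) × Finset (Fin m) // P.1.card = P.2.card} ≃ Fin (N + 1))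
    (γ : GL (Fin m × Fin m) k)
    (hγ : (γ : Matrix (Fin m × Fin m) (Fin m × Fin m) k) =
      Equiv.Perm.permMatrix k (Equiv.prodComm (Fin m) (Fin m))) :
    ∃ P Q : GL (Fin N) k,
      Matrix.linSubstEntries γ
        ((-1 : MvPolynomial (Fin m × Fin m) k) ^
            ((eqv ⟨(univ, univ), rfl⟩ : ℕ) + (eqv ⟨(∅, ∅), rfl⟩ : ℕ)) •
          ((1 - A).submatrix eqv.symm eqv.symm).submatrix (eqv ⟨(univ, univ), rfl⟩).succAbove
            (eqv ⟨(∅, ∅), rfl⟩).succAbove) =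
      (P : Matrix (Fin N) (Fin N) k).map C *
        ((-1 : MvPolynomial (Fin m × Fin m) k) ^
            ((eqv ⟨(univ, univ), rfl⟩ : ℕ) + (eqv ⟨(∅, ∅), rfl⟩ : ℕ)) •
          ((1 - A).submatrix eqv.symm eqv.symm).submatrix (eqv ⟨(univ, univ), rfl⟩).succAbove
            (eqv ⟨(∅, ∅), rfl⟩).succAbove) *
        (Q : Matrix (Fin N) (Fin N) k).map C := by
  let ρ : Equiv.Perm {P : Finset (Fin m) × Finset (Fin m) // P.1.card = P.2.card} :=
    (Equiv.prodComm (Finset (Fin m)) (Finset (Fin m))).subtypeEquiv fun P => by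
      simp [eq_comm]
  have hρ : ∀ P : {P : Finset (Fin m) × Finset (Fin m) // P.1.card = P.2.card},
      (ρ P).1 = (P.1.2, P.1.1) := fun P => rfl
  refine exists_lift_of_relabel eqv (1 - A) γ ρ ⟨(∅, ∅), rfl⟩ ⟨(univ, univ), rfl⟩
    (Subtype.ext (by rw [hρ])) (Subtype.ext (by rw [hρ])) ?_
  rw [hγ]
  exact map_one_sub_eq_submatrix _ ρ fun P Q => linSubst_transpose_apply hA P Q (ρ P) (ρ Q) (hρ P) (hρ Q)

end Lifts

end LRPairs

end Literature.Computability.AlgebraicComplexity
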